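/-
Copyright: the b2b-balaban cell (near-miss cell 7), T⁴-continuum fan-out, lineage t4-ne7b-p3 (node U5c LARGE-DEVIATION
member P3).  Released under the licence of the surrounding project.
-/
import Literature.MathematicalPhysics.QuantumFieldTheory.Balaban1983to89.T4BankedInduction
import Summits.QuantumFields.BalabanUV.T4Continuum.Support.SpaceTimeLedgerMaint

/-!
# Space-time Peierls ∕ Cramér route for NE7b — leaves A3c ∧ A3d ON THE (ID) CARRIER: the contour ledger of a genealogy,
# its BANKING from `T4BankedInduction` at bank `½·credit`, its income bound and its windows

Summits-side support leaf of the T⁴-continuum cell (rung (B)+1 on a FINITE torus only; NOT infinite volume, NOT the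
mass gap, NOT the Clay statement; NOT a proof of the spine estimate NE7b).  Lineage `t4-ne7b-p3` (generation 1), node
U5c, skeleton `t4/skeletons/NE7b-t4-ne7b-p3.md` v1.2 rows ST6 ∕ ST7.  [folklore] finite combinatorics ∕ real arithmetic
over the row's SHARED genealogy carrier `T4PersistenceDictionary.Gen` (lineage t4-ne7b-p1) and its banked induction
`T4BankedInduction` — both imported BY NAME, nothing modified; nothing is quoted from print and nothing printed is
asserted; no `[cite:]` tag.

WHAT.  The CONTOUR route prices a space-time contour (= the lineage of one final live component, skeleton A2b) by its
ledger `SpaceTimePeierlsLeaves.ContourLedger` and needs of it: A3c `IncomeLower`, A3d `Banking` (maintenance ≤ half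
the income), R2 `Windows`, A3b′ `VolumeViaMaint`.  On the (ID) carrier a lineage IS a genealogy `G : Gen ε`
(born ∕ renew ∕ merge), with print's per-step control cost `cost G n` (maintenance) and per-event credits `credit e`
(income) — the data of `T4BankedInduction`.  This file defines the ledger of a genealogy (`ledgerOfGen`: income :=
`credits`, maint := `lifeCost`, epochLen := the sum of the event windows, the structural counts of births ∕ renewals ∕
mergers; the cell-level `vol`, `fat` are parameters) and proves:
* §1 structural facts: `#events = births + renewals + mergers` (well-formed genealogies), `mergers + 1 = births`;
* §2 **A3d = BANKED INDUCTION AT HALF CREDIT** (`banking_ledgerOfGen`): if print's four window-local binders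
  (`T4BankedInduction.Banking`, = (1.81)/(1.82), p.386 ll.1–3, (1.87)/(1.88) of [Balaban1989LargeFieldII] read with the
  thresholds DOUBLED) hold with the bank `e ↦ credit e / 2` and nonnegative reserves, then `lifeCost ≤ credits / 2` —
  `ContourLedger.Banking`; NOT PRINTED as a statement (the node's R1), kernel modulo the four displayed binders;
* §3 A3c `incomeLower_ledgerOfGen` from per-constructor credit binders (birth `≥ γA·p̄₀²·fat b + 2p̄₀`, renewal `≥ p̄₀`,
  merger `≥ 0` — the SHAPES of (1.79) p.383 ∕ p.386, displayed), and R2 `windows_ledgerOfGen` (every window `≤ N′`);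
* §4 the junction with `SpaceTimeLedgerMaint.surplus_ge_rateM_mul_vol`: given also A3b′ for the cell-level volume,
  `rateM · vol ≤ credits − lifeCost` (`surplus_ge_rateM_of_gen`).
Every printed shape is a displayed binder; nothing of Bałaban's is asserted.

HONEST DEPENDENCY (cell, verbatim): continuum YM on T⁴ ⇐ BetaPertH ∧ nine spine estimates (0/9 proved); BetaPertH ⇐
(D1) ∧ (D4) ∧ CAP+tail; G-an2-4 gates asym, D1 and NE2/3/4.  This file changes none of it.
-/

open Finset

namespace Summit.QuantumFields.BalabanUV.T4Continuum.SpaceTimePeierls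

open Literature.MathematicalPhysics.QuantumFieldTheory.Balaban1983to89
open T4PersistenceDictionary T4BankedInduction SpaceTimePeierlsLeaves

noncomputable section

variable {ε : Type*}

/-! ## §1 Structural counts of a genealogy -/

/-- number of births (bare regions created) in a genealogy [folklore] -/
def nBirths : Gen ε → ℕ
  | Gen.born _ _ => 1
  | Gen.renew G _ _ => nBirths G
  | Gen.merge X Y _ => nBirths X + nBirths Y

/-- number of renewal events [folklore] -/
def nRenewals : Gen ε → ℕ
  | Gen.born _ _ => 0
  | Gen.renew G _ _ => nRenewals G + 1
  | Gen.merge X Y _ => nRenewals X + nRenewals Y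

/-- number of merger events [folklore] -/
def nMerges : Gen ε → ℕ
  | Gen.born _ _ => 0
  | Gen.renew G _ _ => nMerges G
  | Gen.merge X Y _ => nMerges X + nMerges Y + 1

/-- the created fatness `Σ_births fat b` for per-birth data `fat : ε → ℕ` [folklore] -/
def fatSum (fat : ε → ℕ) : Gen ε → ℕ
  | Gen.born b _ => fat b
  | Gen.renew G _ _ => fatSum fat G
  | Gen.merge X Y _ => fatSum fat X + fatSum fat Y

/-- a binary merger tree: `mergers + 1 = births` [folklore] -/
theorem nMerges_add_one : ∀ G : Gen ε, nMerges G + 1 = nBirths G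
  | Gen.born _ _ => rfl
  | Gen.renew G _ _ => nMerges_add_one G
  | Gen.merge X Y _ => by
    simp only [nMerges, nBirths, ← nMerges_add_one X, ← nMerges_add_one Y]; omega

variable [DecidableEq ε]

/-- in a WELL-FORMED genealogy the events are distinct, so `#events = births + renewals + mergers` [folklore] -/
theorem card_events_eq (W : ε → ℕ) : ∀ G : Gen ε, G.WF W → G.events.card = nBirths G + nRenewals G + nMerges G
  | Gen.born _ _, _ => by simp [nBirths, nRenewals, nMerges]
  | Gen.renew G e h, hW => by
    simp only [Gen.WF] at hW
    obtain ⟨hG, he, -, -⟩ := hW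
    rw [Gen.events_renew, card_insert_of_notMem he, card_events_eq W G hG]
    simp only [nBirths, nRenewals, nMerges]; omega
  | Gen.merge X Y e, hW => by
    simp only [Gen.WF] at hW
    obtain ⟨hX, hY, heX, heY, hXY, -, -⟩ := hW
    have he : e ∉ X.events ∪ Y.events := by simp [heX, heY]
    rw [Gen.events_merge, card_insert_of_notMem he, card_union_of_disjoint hXY, card_events_eq W X hX,
      card_events_eq W Y hY]
    simp only [nBirths, nRenewals, nMerges]; omega

/-! ## §2 The ledger of a genealogy and its banking at half credit -/

/-- THE CONTOUR LEDGER OF A GENEALOGY on the (ID) carrier: income := the printed credits, maint := the life cost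
(print's maintenance), epochLen := the sum of the event windows, births ∕ renewals ∕ mergers := the structural counts;
the cell-level volume `vol` and the created fatness `fat` are supplied by the occupancy model (A2a∕A2b). [folklore] -/
def ledgerOfGen (W : ε → ℕ) (cost : Gen ε → ℕ → ℝ) (credit : ε → ℝ) (vol fat : ℕ) (G : Gen ε) : ContourLedger where
  vol := vol
  fat := fat
  births := nBirths G
  renewals := nRenewals G
  mergers := nMerges G
  epochLen := ∑ e ∈ G.events, W e
  income := credits credit G
  maint := lifeCost W cost G

/-- with the bank `e ↦ credit e / 2` the banked total is half the credits [folklore] -/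
theorem banks_half (credit : ε → ℝ) (G : Gen ε) : banks (fun e => credit e / 2) G = credits credit G / 2 := by
  simp only [banks, credits, Finset.sum_div]

/-- **A3d ON THE CARRIER = THE BANKED INDUCTION AT HALF CREDIT.**  If print's four window-local binders
(`T4BankedInduction.Banking`: a bare region pays its window, a renewal pays the fresh window, the merged life splits,
the absorbed reserve pays the extension — thresholds DOUBLED) hold with the bank `½·credit` and the reserves are
nonnegative, then along every admissible well-formed genealogy the MAINTENANCE IS AT MOST HALF THE INCOME:
`(ledgerOfGen …).Banking`.  NOT PRINTED as a statement; kernel modulo the displayed binders. [folklore] -/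
theorem banking_ledgerOfGen {adm : Gen ε → Prop} {W : ε → ℕ} {cost : Gen ε → ℕ → ℝ} {credit reserve : ε → ℝ}
    {ext : Gen ε → Gen ε → ε → ℝ} (B : Banking adm W cost credit (fun e => credit e / 2) reserve ext)
    (hres : ∀ e, 0 ≤ reserve e) {G : Gen ε} (hA : adm G) (hG : G.WF W) (vol fat : ℕ) :
    (ledgerOfGen W cost credit vol fat G).Banking := by
  have h := lifeCost_add_banks_le B hA hG (hres _)
  rw [banks_half] at h
  show lifeCost W cost G ≤ credits credit G / 2
  linarith

/-! ## §3 Income from the printed credit shapes; windows -/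

/-- **A3c ON THE CARRIER**: if every admissible birth is credited at least `γA·p̄₀²·fat b + 2·p̄₀` (the shape of the
(1.79) birth factor), every admissible renewal at least `p̄₀` (p.386 «the new factor exp(−p₀(g_j))»), every admissible
merger at least `0`, then `γA·p̄₀²·Σfat + p̄₀·(births + renewals + mergers) ≤ credits` (mergers are paid by the
second `p̄₀` of the births: `mergers + 1 = births`).  Displayed binders; nothing printed asserted. [folklore] -/
theorem credits_ge_of_shapes {adm : Gen ε → Prop} {W : ε → ℕ} {credit : ε → ℝ} {fat : ε → ℕ} {γA pbar : ℝ}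
    (hp : 0 ≤ pbar) (adm_renew : ∀ G e h, adm (Gen.renew G e h) → adm G)
    (adm_merge : ∀ X Y e, adm (Gen.merge X Y e) → adm X ∧ adm Y)
    (hB : ∀ b j, adm (Gen.born b j) → γA * pbar ^ 2 * fat b + 2 * pbar ≤ credit b)
    (hR : ∀ G e h, adm (Gen.renew G e h) → pbar ≤ credit e)
    (hM : ∀ X Y e, adm (Gen.merge X Y e) → 0 ≤ credit e) :
    ∀ G : Gen ε, adm G → G.WF W →
      γA * pbar ^ 2 * fatSum fat G + pbar * (2 * nBirths G + nRenewals G) ≤ credits credit G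
  | Gen.born b j, hA, _ => by
    have := hB b j hA
    simp only [fatSum, nBirths, nRenewals, credits, Gen.events_born, sum_singleton]
    push_cast; linarith
  | Gen.renew G e h, hA, hW => by
    simp only [Gen.WF] at hW
    obtain ⟨hG, he, -, -⟩ := hW
    have IH := credits_ge_of_shapes hp adm_renew adm_merge hB hR hM G (adm_renew G e h hA) hG
    have hc := hR G e h hA
    rw [credits_renew credit h he]
    simp only [fatSum, nBirths, nRenewals]
    push_cast; linarith
  | Gen.merge X Y e, hA, hW => by
    simp only [Gen.WF] at hW
    obtain ⟨hX, hY, heX, heY, hXY, -, -⟩ := hW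
    have IHX := credits_ge_of_shapes hp adm_renew adm_merge hB hR hM X (adm_merge X Y e hA).1 hX
    have IHY := credits_ge_of_shapes hp adm_renew adm_merge hB hR hM Y (adm_merge X Y e hA).2 hY
    have hc := hM X Y e hA
    rw [credits_merge credit heX heY hXY]
    simp only [fatSum, nBirths, nRenewals]
    push_cast; nlinarith

/-- … hence `IncomeLower γA p̄₀` of the genealogy's ledger (with `fat := fatSum fat G`). [folklore] -/
theorem incomeLower_ledgerOfGen {adm : Gen ε → Prop} {W : ε → ℕ} {cost : Gen ε → ℕ → ℝ} {credit : ε → ℝ}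
    {fat : ε → ℕ} {γA pbar : ℝ} (hp : 0 ≤ pbar) (adm_renew : ∀ G e h, adm (Gen.renew G e h) → adm G)
    (adm_merge : ∀ X Y e, adm (Gen.merge X Y e) → adm X ∧ adm Y)
    (hB : ∀ b j, adm (Gen.born b j) → γA * pbar ^ 2 * fat b + 2 * pbar ≤ credit b)
    (hR : ∀ G e h, adm (Gen.renew G e h) → pbar ≤ credit e)
    (hM : ∀ X Y e, adm (Gen.merge X Y e) → 0 ≤ credit e) {G : Gen ε} (hA : adm G) (hG : G.WF W) (vol : ℕ) :
    (ledgerOfGen W cost credit vol (fatSum fat G) G).IncomeLower γA pbar := by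
  have h := credits_ge_of_shapes hp adm_renew adm_merge hB hR hM G hA hG
  have hm := nMerges_add_one G
  show γA * pbar ^ 2 * ((fatSum fat G : ℕ) : ℝ)
      + pbar * (((nBirths G : ℕ) : ℝ) + ((nRenewals G : ℕ) : ℝ) + ((nMerges G : ℕ) : ℝ)) ≤ credits credit G
  have hcast : ((nMerges G : ℕ) : ℝ) + 1 = ((nBirths G : ℕ) : ℝ) := by exact_mod_cast hm
  nlinarith

/-- **R2 ON THE CARRIER**: if every event window of the genealogy is at most `N′` steps then
`Σ_events W ≤ N′ · #events = N′ · (births + renewals + mergers)`: `Windows N′`. [folklore] -/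
theorem windows_ledgerOfGen {W : ε → ℕ} {cost : Gen ε → ℕ → ℝ} {credit : ε → ℝ} {N' : ℕ} {G : Gen ε}
    (hG : G.WF W) (hW : ∀ e ∈ G.events, W e ≤ N') (vol fat : ℕ) :
    (ledgerOfGen W cost credit vol fat G).Windows N' := by
  show (((∑ e ∈ G.events, W e : ℕ)) : ℝ) ≤ (N' : ℝ) * (((nBirths G : ℕ) : ℝ) + ((nRenewals G : ℕ) : ℝ)
      + ((nMerges G : ℕ) : ℝ))
  have h1 : ∑ e ∈ G.events, W e ≤ N' * G.events.card := by
    calc ∑ e ∈ G.events, W e ≤ ∑ _e ∈ G.events, N' := sum_le_sum hW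
      _ = N' * G.events.card := by rw [sum_const, smul_eq_mul, mul_comm]
  rw [card_events_eq W G hG] at h1
  exact_mod_cast h1

/-! ## §4 The junction with the rate: A3b′ ∧ A3c ∧ A3d ∧ R2 on the carrier ⇒ `rateM · vol ≤ credits − lifeCost` -/

/-- **THE PER-CELL RATE OF A GENEALOGY'S CONTOUR.**  Print's banking binders at half credit (A3d), the credit shapes
(A3c), windows `≤ N′` (R2) and — for the cell-level volume `vol` of the contour — the volume-through-maintenance bound
(A3b′, `VolumeViaMaint c_d m₁`, from the occupancy model) give `rateM c_d m₁ p̄₀ N′ · vol ≤ credits − lifeCost`: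
the exponent of the pinned-contour bound decays at rate `rateM` per occupied cell. [folklore] -/
theorem surplus_ge_rateM_of_gen {adm : Gen ε → Prop} {W : ε → ℕ} {cost : Gen ε → ℕ → ℝ} {credit reserve : ε → ℝ}
    {ext : Gen ε → Gen ε → ε → ℝ} {fat : ε → ℕ} {γA pbar cd m₁ : ℝ} {N' : ℕ}
    (B : Banking adm W cost credit (fun e => credit e / 2) reserve ext) (hres : ∀ e, 0 ≤ reserve e)
    (hγ : 0 ≤ γA) (hp : 0 < pbar) (hcd : 0 < cd) (hm : 0 < m₁)
    (hB : ∀ b j, adm (Gen.born b j) → γA * pbar ^ 2 * fat b + 2 * pbar ≤ credit b)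
    (hR : ∀ G e h, adm (Gen.renew G e h) → pbar ≤ credit e)
    (hM : ∀ X Y e, adm (Gen.merge X Y e) → 0 ≤ credit e)
    {G : Gen ε} (hA : adm G) (hG : G.WF W) (hW : ∀ e ∈ G.events, W e ≤ N') {vol : ℕ}
    (hvol : (ledgerOfGen W cost credit vol (fatSum fat G) G).VolumeViaMaint cd m₁) :
    rateM cd m₁ pbar N' * vol ≤ credits credit G - lifeCost W cost G :=
  (ledgerOfGen W cost credit vol (fatSum fat G) G).surplus_ge_rateM_mul_vol hcd hm hγ hp (Nat.cast_nonneg N') hvol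
    (incomeLower_ledgerOfGen hp.le B.adm_renew B.adm_merge hB hR hM hA hG vol) (banking_ledgerOfGen B hres hA hG vol _)
    (windows_ledgerOfGen hG hW vol _)

end

end Summit.QuantumFields.BalabanUV.T4Continuum.SpaceTimePeierls
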